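import Mathlib.Data.Finset.Sort
import Mathlib.Data.Nat.Log
import Literature.Computability.Complexity.AOWOddLevel
import HarnessLib

/-!
# The AOW refutation test for `k`-SAT and its soundness
(Allen–O'Donnell–Witmer 2015, Thm. 2.3 for `P = OR_k`: the deterministic half)

Trunk T-CPLX-CORE (Literature/Computability/Complexity). Support file for the discharge of the
named fact `allen_odonnell_witmer_kSAT` (`AOWRefutation.lean`), deterministic part IV: the
refutation algorithm as a mathematical function and the proof that it NEVER errs.

* `AOWAccepts k n j L` — the acceptance predicate on a multiset `L` of AOW constraints: for
  every non-empty level `S ⊆ [k]` (enumerated through all injective `f : [s] → [k]`) the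
  integer trace test of `AOWLevelMatrix.lean` with the balanced split `(⌈s/2⌉, ⌊s/2⌋)` passes,
  except for the top level of odd `k`, where the odd test of `AOWOddLevel.lean` is used; the
  trace exponent is `q = 2^j`.
* `AOWAccepts.exists_falsified` — **soundness**: if the test passes then EVERY assignment
  falsifies a constraint of `L` (via `2^k |bias_S(x)| < m` for all `S ≠ ∅` and the Fourier
  criterion of `AOWBias.lean`).
* `AOWConstraint.ofClause?`, `parseConstraints` — reading the width-`k` clauses over
  `x_0, …, x_{n-1}` of an arbitrary `CNF ℕ` as constraints (a sub-multiset: refuting it refutes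
  the formula), with `parseConstraints k n (L.map toClause) = L`.
* `aowTraceExp k n` — the exponent: `q = 2^{aowTraceExp k n} ∈ (4k(log₂ n + 1), 8k(log₂ n + 1)]`.
* `aowRefute k n φ : Bool` and `not_satisfiable_of_aowRefute` — the refuter on `(n, φ)` and its
  soundness for every `k ≥ 1` and every input.

What is NOT here: running time (the same function as a polynomial-time TM2 machine) and the
probability that a random `F_{OR_k}(n,p)` instance is accepted — the other two thirds of the
discharge.

## References

* S. R. Allen, R. O'Donnell, D. Witmer, *How to refute a random CSP*, FOCS 2015,
  arXiv:1505.04383: Thm. 2.3, §4.2–4.3 (all levels `∅ ≠ S ⊆ [k]`, Lemma 4.3), App. A.1–A.2.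
-/

namespace Literature.Computability.Complexity

open Finset Matrix

variable {k n : ℕ}

/-! ### The level tests -/

/-- Balanced split shapes `(a, b)`, `s = a + b`: `b ≤ a ≤ b + 1`, `a ≥ 1`, `s ≤ k`, and the top
level of odd `k` excluded (it is treated by the odd test). [Allen–O'Donnell–Witmer 2015, §4.2
(levels `|S| = s`) and App. A.1] [folklore] -/
def IsBalancedShape (k a b : ℕ) : Prop :=
  b ≤ a ∧ a ≤ b + 1 ∧ 0 < a ∧ a + b ≤ k ∧ (a = b + 1 → a + b < k)

/-- `IsBalancedShape` is decidable. [folklore] -/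
instance instDecidableIsBalancedShape (k a b : ℕ) : Decidable (IsBalancedShape k a b) := by
  unfold IsBalancedShape
  infer_instance

/-- The even-type level test for the split `f : [a+b] → [k]` with exponent `q = 2^j`:
`(2^k)^{2q} · ((n^a)^q (n^b)^q · tr((BᵀB)^q)) < m^{2q}` for the level matrix `B`.
[Allen–O'Donnell–Witmer 2015, App. A.1 ("compute ‖B‖") with App. A.4 (trace)] [cite: arXiv150504383, App. A] -/
def LevelCheck (k n j : ℕ) (L : List (AOWConstraint k n)) {a b : ℕ} (f : Fin (a + b) → Fin k) :
    Prop :=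
  ((2 : ℤ) ^ k) ^ (2 * 2 ^ j) *
      (((n : ℤ) ^ a) ^ 2 ^ j * ((n : ℤ) ^ b) ^ 2 ^ j *
        (((levelMatrix L (univ.image f) (f ∘ Fin.castAdd b) (f ∘ Fin.natAdd a))ᵀ *
            levelMatrix L (univ.image f) (f ∘ Fin.castAdd b) (f ∘ Fin.natAdd a)) ^
          2 ^ j).trace) <
    (L.length : ℤ) ^ (2 * 2 ^ j)

/-- `LevelCheck` is decidable (an integer comparison). [folklore] -/
instance instDecidableLevelCheck (k n j : ℕ) (L : List (AOWConstraint k n)) {a b : ℕ}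
    (f : Fin (a + b) → Fin k) : Decidable (LevelCheck k n j L f) := by
  unfold LevelCheck
  infer_instance

/-- The odd top-level test for the split `f : [r+r+1] → [k]`, `q = 2^j`, `w = oddTensor`,
`A = oddMatrix w`: `(2·4^k·n)^{2q} ((n^r)²)^q ((n^r)²)^q tr((AᵀA)^q) < (m²)^{2q}` and
`2·4^k·n·∑ w² < m²`. [Allen–O'Donnell–Witmer 2015, App. A.2 ("compute ‖A‖", "compute ∑ w(T)²")] [cite: arXiv150504383, App. A.2] -/
def OddCheck (k n j : ℕ) (L : List (AOWConstraint k n)) {r : ℕ} (f : Fin (r + r + 1) → Fin k) :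
    Prop :=
  (2 * 4 ^ k * (n : ℤ)) ^ (2 * 2 ^ j) *
        ((((n : ℤ) ^ r) ^ 2) ^ 2 ^ j * (((n : ℤ) ^ r) ^ 2) ^ 2 ^ j *
          (((oddMatrix (oddTensor L (univ.image f) f))ᵀ *
              oddMatrix (oddTensor L (univ.image f) f)) ^ 2 ^ j).trace) <
      ((L.length : ℤ) ^ 2) ^ (2 * 2 ^ j) ∧
    2 * 4 ^ k * (n : ℤ) * ∑ i, ∑ i', ∑ l, oddTensor L (univ.image f) f i i' l ^ 2 <
      (L.length : ℤ) ^ 2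

/-- `OddCheck` is decidable. [folklore] -/
instance instDecidableOddCheck (k n j : ℕ) (L : List (AOWConstraint k n)) {r : ℕ}
    (f : Fin (r + r + 1) → Fin k) : Decidable (OddCheck k n j L f) := by
  unfold OddCheck
  infer_instance

/-- **The AOW acceptance predicate** for `k`-SAT with trace exponent `q = 2^j`: all balanced
level tests over all injective enumerations of all levels, and all odd top-level tests (the
latter family is empty unless `k` is odd, since `[k/2+k/2+1] ↪ [k]` requires `k` odd).
[Allen–O'Donnell–Witmer 2015, Thm. 2.3 via Lemma 4.3 for every `∅ ≠ S ⊆ [k]`] [cite: arXiv150504383, Thm. 2.3] -/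
def AOWAccepts (k n j : ℕ) (L : List (AOWConstraint k n)) : Prop :=
  (∀ a b : Fin (k + 1), IsBalancedShape k a b →
      ∀ f : Fin (a + b) → Fin k, Function.Injective f → LevelCheck k n j L f) ∧
    ∀ f : Fin (k / 2 + k / 2 + 1) → Fin k, Function.Injective f → OddCheck k n j L f

/-- `AOWAccepts` is decidable (finitely many integer comparisons). [folklore] -/
instance instDecidableAOWAccepts (k n j : ℕ) (L : List (AOWConstraint k n)) :
    Decidable (AOWAccepts k n j L) := by
  unfold AOWAccepts
  infer_instance

/-- **Soundness of the AOW test**: if `AOWAccepts k n j L` (`k ≥ 1`) then every assignment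
falsifies some constraint of `L`. [Allen–O'Donnell–Witmer 2015, Thm. 2.3 / §4.3 (all Fourier
levels certified small ⟹ strong refutation), `P = OR_k`] [cite: arXiv150504383, Thm. 2.3] -/
theorem AOWAccepts.exists_falsified (hk : 0 < k) {j : ℕ} {L : List (AOWConstraint k n)}
    (h : AOWAccepts k n j L) (x : Fin n → Bool) : ∃ C ∈ L, C.IsFalsifiedBy x := by
  refine exists_falsified_of_forall_bias_lt hk L x fun S hS => ?_
  have hcard : S.card ≤ k := by simpa using S.card_le_univ
  have hpos : 0 < S.card := Finset.card_pos.2 (Finset.nonempty_iff_ne_empty.2 hS)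
  by_cases hodd : S.card = k ∧ k % 2 = 1
  · -- the top level of odd `k`
    obtain ⟨hSk, hk2⟩ := hodd
    have hr : S.card = k / 2 + k / 2 + 1 := by omega
    have hinj : Function.Injective (S.orderEmbOfFin hr) := (S.orderEmbOfFin hr).injective
    have hc := h.2 (S.orderEmbOfFin hr) hinj
    have hb := two_pow_mul_abs_bias_lt_of_oddCheck L (S.orderEmbOfFin hr) hinj j hc.1 hc.2 x
    rwa [Finset.image_orderEmbOfFin_univ] at hb
  · -- a balanced level
    set a := (S.card + 1) / 2 with ha
    set b := S.card / 2 with hb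
    have hab : S.card = a + b := by omega
    have hshape : IsBalancedShape k a b := by
      refine ⟨by omega, by omega, by omega, by omega, fun h1 => ?_⟩
      by_contra hge
      exact hodd ⟨by omega, by omega⟩
    have hinj : Function.Injective (S.orderEmbOfFin hab) := (S.orderEmbOfFin hab).injective
    have hc : LevelCheck k n j L (S.orderEmbOfFin hab) :=
      h.1 ⟨a, by omega⟩ ⟨b, by omega⟩ hshape (S.orderEmbOfFin hab) hinj
    have hb := two_pow_mul_abs_bias_lt_of_levelCheck L (S.orderEmbOfFin hab) hinj j hc x
    rwa [Finset.image_orderEmbOfFin_univ] at hb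

/-- Soundness at the level of CNFs: if every clause of `L` occurs in `φ` and the test accepts,
`φ` is unsatisfiable. [Allen–O'Donnell–Witmer 2015, Thm. 2.3 (a refutation algorithm never
errs, Def. 3.7)] [cite: arXiv150504383, Thm. 2.3] -/
theorem AOWAccepts.not_satisfiable (hk : 0 < k) {j : ℕ} {L : List (AOWConstraint k n)}
    (h : AOWAccepts k n j L) {φ : CNF ℕ} (hsub : ∀ C ∈ L, C.toClause ∈ φ) : ¬ φ.Satisfiable :=
  not_satisfiable_of_forall_exists_falsified L hsub (h.exists_falsified hk)

/-! ### Reading constraints off a CNF -/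

namespace AOWConstraint

/-- Parse a clause as an AOW constraint of arity `k` over `x_0, …, x_{n-1}`: succeeds iff the
clause has exactly `k` literals, all on variables `< n` (repetitions allowed, as in AOW's model).
[Allen–O'Donnell–Witmer 2015, Def. 3.1] [folklore] -/
def ofClause? (k n : ℕ) (c : Clause ℕ) : Option (AOWConstraint k n) :=
  if h : c.length = k ∧ ∀ l ∈ c, l.1 < n then
    some (fun i => ⟨(c.get (i.cast h.1.symm)).1, h.2 _ (List.get_mem c _)⟩,
      fun i => (c.get (i.cast h.1.symm)).2)
  else none

/-- A successfully parsed clause is the clause of the parsed constraint. [folklore] -/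
theorem toClause_eq_of_ofClause? {k n : ℕ} {c : Clause ℕ} {C : AOWConstraint k n}
    (h : ofClause? k n c = some C) : C.toClause = c := by
  unfold ofClause? at h
  split_ifs at h with hc
  rw [Option.some.injEq] at h
  subst h
  apply List.ext_get
  · simp [toClause, hc.1]
  · intro i h1 h2
    simp [toClause, List.getElem_ofFn]
    rfl

/-- Parsing the clause of a constraint returns the constraint. [folklore] -/
theorem ofClause?_toClause {k n : ℕ} (C : AOWConstraint k n) : ofClause? k n C.toClause = some C := by
  have hc : C.toClause.length = k ∧ ∀ l ∈ C.toClause, l.1 < n := by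
    refine ⟨C.length_toClause, fun l hl => ?_⟩
    simp only [toClause, List.mem_ofFn] at hl
    obtain ⟨i, rfl⟩ := hl
    exact (C.1 i).isLt
  unfold ofClause?
  rw [dif_pos hc, Option.some.injEq]
  obtain ⟨T, c⟩ := C
  refine Prod.ext ?_ ?_
  · funext i
    apply Fin.ext
    simp [toClause]
  · funext i
    simp [toClause]

end AOWConstraint

/-- The constraints read off a CNF: the sub-multiset of its width-`k` clauses over
`x_0, …, x_{n-1}`, as AOW constraints. [Allen–O'Donnell–Witmer 2015, Def. 3.1] [folklore] -/
def parseConstraints (k n : ℕ) (φ : CNF ℕ) : List (AOWConstraint k n) :=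
  φ.filterMap (AOWConstraint.ofClause? k n)

/-- Every parsed constraint comes from a clause of `φ`. [folklore] -/
theorem toClause_mem_of_mem_parseConstraints {φ : CNF ℕ} {C : AOWConstraint k n}
    (h : C ∈ parseConstraints k n φ) : C.toClause ∈ φ := by
  rw [parseConstraints, List.mem_filterMap] at h
  obtain ⟨c, hc, hC⟩ := h
  rwa [AOWConstraint.toClause_eq_of_ofClause? hC]

/-- Parsing the clause list of a constraint list returns the list (so on AOW's random instances
the algorithm sees exactly the sampled constraints). [folklore] -/
theorem parseConstraints_map_toClause (L : List (AOWConstraint k n)) :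
    parseConstraints k n (L.map AOWConstraint.toClause) = L := by
  rw [parseConstraints, List.filterMap_map]
  have : (AOWConstraint.ofClause? k n ∘ AOWConstraint.toClause) = (some : AOWConstraint k n → _) :=
    funext fun C => AOWConstraint.ofClause?_toClause C
  rw [this, List.filterMap_some]

/-! ### The refuter -/

/-- The trace exponent: `q = 2^{aowTraceExp k n}` with `4k(log₂ n + 1) < q ≤ 8k(log₂ n + 1)` (for
`k ≥ 1`); `q = Θ_k(log n)` as in the trace method, large enough to beat the `n^{O(k)}` prefactors
of the moment bounds. [Allen–O'Donnell–Witmer 2015, App. A.4 (Claim: `r = Θ(log n)`)] [cite: arXiv150504383, App. A] -/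
def aowTraceExp (k n : ℕ) : ℕ :=
  Nat.log 2 (4 * k * (Nat.log 2 n + 1)) + 1

/-- `4k(log₂ n + 1) < 2^{aowTraceExp k n}`. [folklore] -/
theorem lt_two_pow_aowTraceExp (k n : ℕ) : 4 * k * (Nat.log 2 n + 1) < 2 ^ aowTraceExp k n :=
  Nat.lt_pow_succ_log_self (by norm_num) _

/-- `2^{aowTraceExp k n} ≤ 8k(log₂ n + 1)` for `k ≥ 1`. [folklore] -/
theorem two_pow_aowTraceExp_le (hk : 0 < k) (n : ℕ) : 2 ^ aowTraceExp k n ≤ 8 * k * (Nat.log 2 n + 1) := by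
  have hne : 4 * k * (Nat.log 2 n + 1) ≠ 0 := by positivity
  calc 2 ^ aowTraceExp k n = 2 * 2 ^ Nat.log 2 (4 * k * (Nat.log 2 n + 1)) := by rw [aowTraceExp, pow_succ']
    _ ≤ 2 * (4 * k * (Nat.log 2 n + 1)) :=
        Nat.mul_le_mul_left 2 (Nat.pow_log_le_self 2 hne)
    _ = 8 * k * (Nat.log 2 n + 1) := by ring

/-- **The AOW refuter for `k`-SAT** as a function of `(n, φ)`: accept iff the constraints read
off `φ` pass `AOWAccepts` with exponent `aowTraceExp k n`. [Allen–O'Donnell–Witmer 2015, Thm. 2.3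
(`P = OR_k`)] [cite: arXiv150504383, Thm. 2.3] -/
def aowRefute (k n : ℕ) (φ : CNF ℕ) : Bool :=
  decide (AOWAccepts k n (aowTraceExp k n) (parseConstraints k n φ))

/-- **The refuter never errs**: if `aowRefute k n φ = true` (`k ≥ 1`) then `φ` is
unsatisfiable — for every `n` and every CNF `φ` whatsoever. [Allen–O'Donnell–Witmer 2015,
Thm. 2.3 with Def. 3.7] [cite: arXiv150504383, Thm. 2.3] -/
theorem not_satisfiable_of_aowRefute (hk : 0 < k) {φ : CNF ℕ} (h : aowRefute k n φ = true) :
    ¬ φ.Satisfiable :=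
  (of_decide_eq_true h : AOWAccepts k n (aowTraceExp k n) (parseConstraints k n φ)).not_satisfiable hk
    fun _ hC => toClause_mem_of_mem_parseConstraints hC

end Literature.Computability.Complexity
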